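import Mathlib.Analysis.SpecialFunctions.Trigonometric.Chebyshev.Basic
import Mathlib.Analysis.SpecialFunctions.Trigonometric.Inverse
import Mathlib.Algebra.Polynomial.Roots
import Mathlib.Topology.Algebra.InfiniteSum.ENNReal
import Literature.Analysis.Fourier.FejerJacksonKernels
import HarnessLib

/-!
# Dyadic Fejér telescoping: an exact multiscale decomposition of `1/sin²(πx)`

An elementary, exact and positivity-preserving multiscale decomposition of the symbol of the
one-dimensional lattice Green's function.  With the Fejér kernel
`F_M(x) = |Σ_{j=0}^{M} e(jx)|²/(M+1) = sin²(π(M+1)x)/((M+1) sin²(πx))` of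
`Literature.Analysis.Fourier.TrigApprox` (`FejerJacksonKernels.lean`):

* `dirSum_double`, `fejer_double` — the doubling identity `F_{2m+1}(x) = 2cos²(π(m+1)x) F_m(x)`
  (from `D_{2m+1} = (1 + e((m+1)x)) D_m`);
* `fejer_two_pow_succ_div` — for the dyadic ratios `ρ_N := F_{2^N−1}/2^N`:
  `ρ_{N+1} = cos²(π 2^N x) ρ_N`, whence `ρ_J = Π_{i<J} cos²(π 2^i x)` (`fejer_two_pow_div_eq_prod`,
  Viète's product);
* **`fejer_dyadic_telescope`** — for every real `x` and every `J`,
  `sin²(πx) · Σ_{N<J} F_{2^N−1}(x)² + F_{2^J−1}(x)/2^J = 1`;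
  so for `x ∉ ℤ` the squares `F_{2^N−1}²` (Jackson-type kernels, trigonometric polynomials of
  degree `2^{N+1} − 2`, `0 ≤ F_{2^N−1}² ≤ min(4^N, 1/(16·4^N x⁴))`) sum to `1/sin²(πx)`
  (`hasSum_fejer_sq_dyadic`), with the nonnegative remainder `ρ_J/sin²(πx)`, `ρ_J ≤ min(1, 1/(4^{J+1}x²))`;
* the same identities as POLYNOMIAL identities in `c = cos(2πx)` (`fejerPoly M`, the cosine
  polynomial of `fejer_eq` written in Chebyshev polynomials, `fejerPoly_eval_cos`):
  `(1−X)/2 · Σ_{N<J} P_{2^N−1}² + P_{2^J−1}/2^J = 1` (`fejerPoly_dyadic_identity`) and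
  `P_{2^J−1}/2^J = Π_{i<J} (1 + T_{2^i})/2 = (1+X)/2 · (Π_{i<J−1} T_{2^i})²`
  (`fejerPoly_two_pow_eq_prod`, `fejerPoly_two_pow_eq_sq`).

Evaluated at `B = 1 − A/2` for a finite-range positive operator `0 ≤ A ≤ 4` these give an exact
finite-range decomposition `A · Σ_N C_N + R_J = 1` with positive semidefinite pieces
`C_N = ¼ P_{2^N−1}(B)²` of range `< 2^{N+1}·range(A)` — the discrete finite-range decompositions of
[cite: BrydgesGuadagniMitter2004, Thm. 1.1] / [cite: Bauerschmidt2013, Thm. 1.2] obtained here by pure polynomial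
calculus (see `Literature/Analysis/Matrix/FiniteRangeDecomposition.lean`).  The telescoping proof is
ours; every statement is elementary ([folklore] tags below).

## References

* [BrydgesGuadagniMitter2004] D. Brydges, G. Guadagni, P. Mitter, Finite range decomposition of
  Gaussian processes, J. Stat. Phys. 115 (2004) 415–449, doi:10.1023/b:joss.0000019818.81237.66, Thm. 1.1.
* [Bauerschmidt2013] R. Bauerschmidt, A simple method for finite range decomposition of quadratic
  forms and Gaussian fields, Probab. Theory Relat. Fields 157 (2013) 817–845, §1.2–§3.
* [Travaglini2014] G. Travaglini, Number Theory, Fourier Analysis and Geometric Discrepancy, CUP 2014,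
  §7.1 (Fejér and Jackson kernels).
-/

noncomputable section

open Real Finset Polynomial

namespace Literature.Analysis.Fourier.TrigApprox

/-! ## Doubling identities -/

/-- `D_{2m+1}(x) = (1 + e((m+1)x)) · D_m(x)`. [folklore] -/
theorem dirSum_double (m : ℕ) (x : ℝ) :
    dirSum (2 * m + 1) x = (1 + e ((m + 1 : ℕ) * x)) * dirSum m x := by
  unfold dirSum
  rw [show 2 * m + 1 + 1 = (m + 1) + (m + 1) by ring, Finset.sum_range_add, add_mul, one_mul,
    Finset.mul_sum]
  congr 1
  refine Finset.sum_congr rfl fun j _ => ?_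
  rw [← e_add]
  congr 1
  push_cast
  ring

/-- `‖1 + e(t)‖² = 4 cos²(πt)`. [folklore] -/
theorem norm_one_add_e_sq (t : ℝ) : ‖1 + e t‖ ^ 2 = 4 * Real.cos (π * t) ^ 2 := by
  unfold e
  rw [show (2 * π * Complex.I * t : ℂ) = ((2 * π * t : ℝ) : ℂ) * Complex.I by push_cast; ring,
    Complex.exp_mul_I, ← Complex.ofReal_cos, ← Complex.ofReal_sin,
    show (1 : ℂ) + ((Real.cos (2 * π * t) : ℂ) + (Real.sin (2 * π * t) : ℂ) * Complex.I)
      = ((1 + Real.cos (2 * π * t) : ℝ) : ℂ) + ((Real.sin (2 * π * t) : ℝ) : ℂ) * Complex.I by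
        push_cast; ring,
    ← Complex.normSq_eq_norm_sq, Complex.normSq_add_mul_I]
  have h : Real.cos (π * t) ^ 2 = 1 / 2 + Real.cos (2 * π * t) / 2 := by
    rw [show 2 * π * t = 2 * (π * t) by ring]; exact Real.cos_sq _
  nlinarith [Real.sin_sq_add_cos_sq (2 * π * t)]

/-- **Doubling for the Fejér kernel**: `F_{2m+1}(x) = 2 cos²(π(m+1)x) · F_m(x)`. [folklore] -/
theorem fejer_double (m : ℕ) (x : ℝ) :
    fejer (2 * m + 1) x = 2 * Real.cos (π * ((m : ℝ) + 1) * x) ^ 2 * fejer m x := by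
  unfold fejer
  rw [dirSum_double, norm_mul, mul_pow, norm_one_add_e_sq]
  have hm : (0 : ℝ) < m + 1 := by positivity
  push_cast
  rw [show π * ((m : ℝ) + 1) * x = π * (((m : ℝ) + 1) * x) by ring]
  field_simp
  ring

/-- `((2^N − 1 : ℕ) : ℝ) + 1 = 2^N`. [folklore] -/
private theorem cast_two_pow_sub_one_add_one (N : ℕ) : ((2 ^ N - 1 : ℕ) : ℝ) + 1 = 2 ^ N := by
  rw [Nat.cast_sub Nat.one_le_two_pow]; push_cast; ring

/-- **Dyadic ratio recursion**: with `ρ_N(x) := F_{2^N−1}(x)/2^N`,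
`ρ_{N+1}(x) = cos²(π 2^N x) · ρ_N(x)`. [folklore] -/
theorem fejer_two_pow_succ_div (N : ℕ) (x : ℝ) :
    fejer (2 ^ (N + 1) - 1) x / 2 ^ (N + 1)
      = Real.cos (π * (2 ^ N * x)) ^ 2 * (fejer (2 ^ N - 1) x / 2 ^ N) := by
  have h2 : 2 ^ (N + 1) - 1 = 2 * (2 ^ N - 1) + 1 := by
    have := Nat.one_le_two_pow (n := N); rw [pow_succ]; omega
  rw [h2, fejer_double, cast_two_pow_sub_one_add_one,
    show π * 2 ^ N * x = π * (2 ^ N * x) by ring]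
  field_simp
  ring

/-- **Viète form of the dyadic ratio**: `F_{2^J−1}(x)/2^J = Π_{i<J} cos²(π 2^i x)`. [folklore] -/
theorem fejer_two_pow_div_eq_prod (J : ℕ) (x : ℝ) :
    fejer (2 ^ J - 1) x / 2 ^ J = ∏ i ∈ Finset.range J, Real.cos (π * (2 ^ i * x)) ^ 2 := by
  induction J with
  | zero => simp [fejer, dirSum, e_zero]
  | succ J ih => rw [fejer_two_pow_succ_div, Finset.prod_range_succ, ih, mul_comm]

/-- `sin²(πx) · F_m(x)² = F_m(x) · sin²(π(m+1)x)/(m+1)`. [folklore] -/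
theorem sin_sq_mul_fejer_sq (m : ℕ) (x : ℝ) :
    Real.sin (π * x) ^ 2 * fejer m x ^ 2
      = fejer m x * Real.sin (π * ((m : ℝ) + 1) * x) ^ 2 / ((m : ℝ) + 1) := by
  have h := fejer_mul_sin_sq m x
  have hm : (0 : ℝ) < m + 1 := by positivity
  rw [← h]
  field_simp

/-! ## The telescoping identity -/

/-- **Dyadic Fejér telescoping.**  For every real `x` and every `J : ℕ`,
`sin²(πx) · Σ_{N<J} F_{2^N−1}(x)² + F_{2^J−1}(x)/2^J = 1`.
(Induction on `J`: `ρ_J − ρ_{J+1} = ρ_J sin²(π2^J x) = sin²(πx) F_{2^J−1}(x)²`.) [folklore] -/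
theorem fejer_dyadic_telescope (J : ℕ) (x : ℝ) :
    Real.sin (π * x) ^ 2 * ∑ N ∈ Finset.range J, fejer (2 ^ N - 1) x ^ 2
      + fejer (2 ^ J - 1) x / 2 ^ J = 1 := by
  induction J with
  | zero => simp [fejer, dirSum, e_zero]
  | succ J ih =>
    rw [Finset.sum_range_succ, mul_add, fejer_two_pow_succ_div]
    have key : Real.sin (π * x) ^ 2 * fejer (2 ^ J - 1) x ^ 2
        = Real.sin (π * (2 ^ J * x)) ^ 2 * (fejer (2 ^ J - 1) x / 2 ^ J) := by
      rw [sin_sq_mul_fejer_sq, cast_two_pow_sub_one_add_one,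
        show π * 2 ^ J * x = π * (2 ^ J * x) by ring]
      ring
    rw [key]
    linear_combination ih + fejer (2 ^ J - 1) x / 2 ^ J * Real.sin_sq_add_cos_sq (π * (2 ^ J * x))

/-- The telescoping identity solved for the partial sums, off the integers:
`Σ_{N<J} F_{2^N−1}(x)² = (1 − F_{2^J−1}(x)/2^J)/sin²(πx)` when `sin(πx) ≠ 0`. [folklore] -/
theorem sum_fejer_sq_dyadic_eq (J : ℕ) {x : ℝ} (hx : Real.sin (π * x) ≠ 0) :
    ∑ N ∈ Finset.range J, fejer (2 ^ N - 1) x ^ 2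
      = (1 - fejer (2 ^ J - 1) x / 2 ^ J) / Real.sin (π * x) ^ 2 := by
  have h := fejer_dyadic_telescope J x
  have hs : Real.sin (π * x) ^ 2 ≠ 0 := pow_ne_zero 2 hx
  rw [eq_div_iff hs]
  linear_combination h

/-! ## Size of the pieces and of the remainder -/

/-- `F_m(x)² ≤ (m+1)²`. [folklore] -/
theorem fejer_sq_le (m : ℕ) (x : ℝ) : fejer m x ^ 2 ≤ ((m : ℝ) + 1) ^ 2 :=
  pow_le_pow_left₀ (fejer_nonneg m x) (fejer_le m x) 2

/-- `F_m(x)² ≤ 1/(16 (m+1)² x⁴)` for `0 < |x| ≤ 1/2`. [folklore] -/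
theorem fejer_sq_le_inv (m : ℕ) {x : ℝ} (hx0 : x ≠ 0) (hx : |x| ≤ 1 / 2) :
    fejer m x ^ 2 ≤ 1 / (16 * ((m : ℝ) + 1) ^ 2 * x ^ 4) := by
  have h := fejer_le_inv m hx0 hx
  have hm : (0 : ℝ) < m + 1 := by positivity
  calc fejer m x ^ 2 ≤ (1 / (4 * (m + 1) * x ^ 2)) ^ 2 := pow_le_pow_left₀ (fejer_nonneg m x) h 2
    _ = 1 / (16 * ((m : ℝ) + 1) ^ 2 * x ^ 4) := by field_simp; ring

/-- The dyadic piece: `F_{2^N−1}(x)² ≤ 4^N`. [folklore] -/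
theorem fejer_sq_dyadic_le (N : ℕ) (x : ℝ) : fejer (2 ^ N - 1) x ^ 2 ≤ 4 ^ N := by
  have h := fejer_sq_le (2 ^ N - 1) x
  rw [cast_two_pow_sub_one_add_one, ← pow_mul, show (2 : ℝ) ^ (N * 2) = 4 ^ N by
    rw [mul_comm, pow_mul]; norm_num] at h
  exact h

/-- The dyadic piece: `F_{2^N−1}(x)² ≤ 1/(16 · 4^N · x⁴)` for `0 < |x| ≤ 1/2`. [folklore] -/
theorem fejer_sq_dyadic_le_inv (N : ℕ) {x : ℝ} (hx0 : x ≠ 0) (hx : |x| ≤ 1 / 2) :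
    fejer (2 ^ N - 1) x ^ 2 ≤ 1 / (16 * 4 ^ N * x ^ 4) := by
  have h := fejer_sq_le_inv (2 ^ N - 1) hx0 hx
  rw [cast_two_pow_sub_one_add_one, ← pow_mul, show (2 : ℝ) ^ (N * 2) = 4 ^ N by
    rw [mul_comm, pow_mul]; norm_num] at h
  exact h

/-- The remainder ratio is at most one: `F_{2^J−1}(x)/2^J ≤ 1`. [folklore] -/
theorem fejer_two_pow_div_le_one (J : ℕ) (x : ℝ) : fejer (2 ^ J - 1) x / 2 ^ J ≤ 1 := by
  rw [div_le_one (by positivity)]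
  have h := fejer_le (2 ^ J - 1) x
  rwa [cast_two_pow_sub_one_add_one] at h

/-- The remainder ratio is nonnegative. [folklore] -/
theorem fejer_two_pow_div_nonneg (J : ℕ) (x : ℝ) : 0 ≤ fejer (2 ^ J - 1) x / 2 ^ J :=
  div_nonneg (fejer_nonneg _ _) (by positivity)

/-- The remainder ratio decays: `F_{2^J−1}(x)/2^J ≤ 1/(4 · 4^J · x²)` for `0 < |x| ≤ 1/2`. [folklore] -/
theorem fejer_two_pow_div_le_inv (J : ℕ) {x : ℝ} (hx0 : x ≠ 0) (hx : |x| ≤ 1 / 2) :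
    fejer (2 ^ J - 1) x / 2 ^ J ≤ 1 / (4 * 4 ^ J * x ^ 2) := by
  have h := fejer_le_inv (2 ^ J - 1) hx0 hx
  rw [cast_two_pow_sub_one_add_one] at h
  have hx2 : 0 < x ^ 2 := by positivity
  rw [div_le_iff₀ (by positivity)]
  calc fejer (2 ^ J - 1) x ≤ 1 / (4 * 2 ^ J * x ^ 2) := h
    _ = 1 / (4 * 4 ^ J * x ^ 2) * 2 ^ J := by
        rw [show (4 : ℝ) ^ J = 2 ^ J * 2 ^ J by rw [← mul_pow]; norm_num]
        field_simp

/-- **The full series.**  For `0 < |x| ≤ 1/2` the squared dyadic Fejér kernels sum to the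
Green's-function symbol: `Σ_{N≥0} F_{2^N−1}(x)² = 1/sin²(πx)`. [folklore] -/
theorem hasSum_fejer_sq_dyadic {x : ℝ} (hx0 : x ≠ 0) (hx : |x| ≤ 1 / 2) :
    HasSum (fun N : ℕ => fejer (2 ^ N - 1) x ^ 2) (1 / Real.sin (π * x) ^ 2) := by
  -- `sin(πx) ≠ 0` on `0 < |x| ≤ 1/2`
  have hsin : Real.sin (π * x) ≠ 0 := by
    intro h0
    rw [Real.sin_eq_zero_iff] at h0
    obtain ⟨n, hn⟩ := h0
    have hxn : x = n := (mul_right_cancel₀ Real.pi_ne_zero (hn.trans (mul_comm π x))).symm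
    have h1 : |(n : ℝ)| ≤ 1 / 2 := hxn ▸ hx
    have h2 : (n : ℝ) ≠ 0 := hxn ▸ hx0
    have h3 : |(n : ℝ)| < 1 := by linarith
    rw [← Int.cast_abs, ← Int.cast_one, Int.cast_lt] at h3
    have : n = 0 := by
      rcases abs_lt.mp h3 with ⟨h4, h5⟩; omega
    exact h2 (by simp [this])
  rw [hasSum_iff_tendsto_nat_of_nonneg (fun N => sq_nonneg _)]
  have hlim : Filter.Tendsto (fun J : ℕ => fejer (2 ^ J - 1) x / 2 ^ J) Filter.atTop (nhds 0) := by
    -- squeezed between `0` and `1/(4·4^J x²) → 0`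
    have hgeom : Filter.Tendsto (fun J : ℕ => 1 / (4 * x ^ 2) * (1 / 4 : ℝ) ^ J) Filter.atTop
        (nhds 0) := by
      rw [show (0 : ℝ) = 1 / (4 * x ^ 2) * 0 by ring]
      exact (tendsto_pow_atTop_nhds_zero_of_lt_one (by norm_num) (by norm_num)).const_mul _
    refine squeeze_zero (fun J => fejer_two_pow_div_nonneg J x) (fun J => ?_) hgeom
    calc fejer (2 ^ J - 1) x / 2 ^ J ≤ 1 / (4 * 4 ^ J * x ^ 2) := fejer_two_pow_div_le_inv J hx0 hx
      _ = 1 / (4 * x ^ 2) * (1 / 4 : ℝ) ^ J := by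
          have hx2 : x ^ 2 ≠ 0 := pow_ne_zero 2 hx0
          field_simp
          rw [← mul_pow]; norm_num
  have heq : (fun J : ℕ => ∑ N ∈ Finset.range J, fejer (2 ^ N - 1) x ^ 2)
      = fun J : ℕ => (1 - fejer (2 ^ J - 1) x / 2 ^ J) / Real.sin (π * x) ^ 2 := by
    funext J; exact sum_fejer_sq_dyadic_eq J hsin
  rw [heq, show 1 / Real.sin (π * x) ^ 2 = (1 - 0) / Real.sin (π * x) ^ 2 by ring]
  exact ((tendsto_const_nhds.sub hlim).div_const _)

/-! ## The same identities for the Fejér–Chebyshev polynomials -/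

/-- **The Fejér–Chebyshev polynomial** `P_M := 1 + (2/(M+1)) Σ_{h=1}^{M} (M+1−h) T_h ∈ ℝ[X]`
(`T_h` the Chebyshev polynomials of the first kind), the cosine polynomial of `fejer_eq`:
`P_M(cos 2πx) = F_M(x)`. [folklore] -/
def fejerPoly (M : ℕ) : ℝ[X] :=
  1 + Polynomial.C (2 / ((M : ℝ) + 1)) *
    ∑ h ∈ Finset.Icc 1 M, Polynomial.C ((M : ℝ) + 1 - h) * Polynomial.Chebyshev.T ℝ h

/-- `P_M(cos 2πx) = F_M(x)`. [folklore] -/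
theorem fejerPoly_eval_cos (M : ℕ) (x : ℝ) :
    (fejerPoly M).eval (Real.cos (2 * π * x)) = fejer M x := by
  rw [fejer_eq, fejerPoly]
  simp only [eval_add, eval_one, eval_mul, eval_C, eval_finsetSum]
  congr 1
  congr 1
  refine Finset.sum_congr rfl fun h _ => ?_
  rw [Polynomial.Chebyshev.T_real_cos,
    show ((h : ℤ) : ℝ) * (2 * π * x) = 2 * π * h * x by push_cast; ring]

/-- `deg P_M ≤ M`. [folklore] -/
theorem natDegree_fejerPoly_le (M : ℕ) : (fejerPoly M).natDegree ≤ M := by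
  unfold fejerPoly
  refine (natDegree_add_le _ _).trans (max_le (by simp) ?_)
  refine (natDegree_C_mul_le _ _).trans ?_
  refine natDegree_sum_le_of_forall_le _ _ fun h hh => ?_
  refine (natDegree_C_mul_le _ _).trans ?_
  rw [Polynomial.Chebyshev.natDegree_T]
  simp only [Int.natAbs_natCast]
  exact (Finset.mem_Icc.mp hh).2

/-- `P_0 = 1`. [folklore] -/
@[simp] theorem fejerPoly_zero : fejerPoly 0 = 1 := by
  simp [fejerPoly]

/-- Every `y ∈ [−1, 1]` is `cos(2πx)` for some real `x`. [folklore] -/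
private theorem exists_cos_two_pi_mul_eq {y : ℝ} (hy : y ∈ Set.Icc (-1 : ℝ) 1) :
    ∃ x : ℝ, Real.cos (2 * π * x) = y :=
  ⟨Real.arccos y / (2 * π), by
    rw [mul_div_cancel₀ _ (by positivity : (2 * π : ℝ) ≠ 0)]
    exact Real.cos_arccos hy.1 hy.2⟩

/-- Two real polynomials that agree at every `cos(2πx)` are equal. [folklore] -/
private theorem poly_eq_of_eval_cos_eq {p q : ℝ[X]}
    (h : ∀ x : ℝ, p.eval (Real.cos (2 * π * x)) = q.eval (Real.cos (2 * π * x))) : p = q := by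
  apply Polynomial.eq_of_infinite_eval_eq
  refine Set.Infinite.mono (fun y hy => ?_) (Set.Icc_infinite (show (-1 : ℝ) < 1 by norm_num))
  obtain ⟨x, rfl⟩ := exists_cos_two_pi_mul_eq hy
  exact h x

/-- `sin²(πx) = (1 − cos 2πx)/2`. [folklore] -/
private theorem sin_sq_pi_mul (x : ℝ) :
    Real.sin (π * x) ^ 2 = 1 / 2 * (1 - Real.cos (2 * π * x)) := by
  have h : Real.cos (π * x) ^ 2 = 1 / 2 + Real.cos (2 * π * x) / 2 := by
    rw [show 2 * π * x = 2 * (π * x) by ring]; exact Real.cos_sq _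
  rw [Real.sin_sq, h]; ring

/-- **Dyadic telescoping as a polynomial identity**:
`(1−X)/2 · Σ_{N<J} P_{2^N−1}² + P_{2^J−1}/2^J = 1` in `ℝ[X]`. [folklore] -/
theorem fejerPoly_dyadic_identity (J : ℕ) :
    Polynomial.C (1 / 2 : ℝ) * (1 - X) * ∑ N ∈ Finset.range J, fejerPoly (2 ^ N - 1) ^ 2
      + Polynomial.C (1 / 2 ^ J : ℝ) * fejerPoly (2 ^ J - 1) = 1 := by
  apply poly_eq_of_eval_cos_eq
  intro x
  simp only [eval_add, eval_mul, eval_C, eval_sub, eval_one, eval_X, eval_finsetSum, eval_pow,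
    fejerPoly_eval_cos]
  have h := fejer_dyadic_telescope J x
  rw [sin_sq_pi_mul] at h
  linear_combination h

/-- **Viète form as a polynomial identity**: `P_{2^J−1}/2^J = Π_{i<J} (1 + T_{2^i})/2`. [folklore] -/
theorem fejerPoly_two_pow_eq_prod (J : ℕ) :
    Polynomial.C (1 / 2 ^ J : ℝ) * fejerPoly (2 ^ J - 1)
      = ∏ i ∈ Finset.range J,
          (Polynomial.C (1 / 2 : ℝ) * (1 + Polynomial.Chebyshev.T ℝ (2 ^ i))) := by
  apply poly_eq_of_eval_cos_eq
  intro x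
  simp only [eval_mul, eval_C, eval_prod, eval_add, eval_one, fejerPoly_eval_cos,
    Polynomial.Chebyshev.T_real_cos]
  rw [show 1 / 2 ^ J * fejer (2 ^ J - 1) x = fejer (2 ^ J - 1) x / 2 ^ J by ring,
    fejer_two_pow_div_eq_prod]
  refine Finset.prod_congr rfl fun i _ => ?_
  rw [show (((2 : ℤ) ^ i : ℤ) : ℝ) * (2 * π * x) = 2 * (π * (2 ^ i * x)) by push_cast; ring,
    Real.cos_sq]
  ring

/-- `1 + T_{2k} = 2 T_k²`. [folklore] -/
theorem one_add_T_two_mul (k : ℤ) :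
    1 + Polynomial.Chebyshev.T ℝ (2 * k) = 2 * Polynomial.Chebyshev.T ℝ k ^ 2 := by
  rw [Polynomial.Chebyshev.T_mul, Polynomial.Chebyshev.T_two]
  simp only [sub_comp, mul_comp, pow_comp, X_comp, one_comp]
  norm_num

/-- **Square form of the remainder**: for `J ≥ 1`,
`P_{2^J−1}/2^J = (1+X)/2 · (Π_{i<J−1} T_{2^i})²`. [folklore] -/
theorem fejerPoly_two_pow_eq_sq (J : ℕ) (hJ : 1 ≤ J) :
    Polynomial.C (1 / 2 ^ J : ℝ) * fejerPoly (2 ^ J - 1)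
      = Polynomial.C (1 / 2 : ℝ) * (1 + X) *
          (∏ i ∈ Finset.range (J - 1), Polynomial.Chebyshev.T ℝ (2 ^ i)) ^ 2 := by
  rw [fejerPoly_two_pow_eq_prod]
  obtain ⟨J, rfl⟩ : ∃ J', J = J' + 1 := ⟨J - 1, by omega⟩
  rw [Finset.prod_range_succ', Nat.add_sub_cancel, ← Finset.prod_pow]
  simp only [pow_zero, Polynomial.Chebyshev.T_one]
  rw [mul_comm]
  congr 1
  refine Finset.prod_congr rfl fun i _ => ?_
  rw [pow_succ, mul_comm ((2 : ℤ) ^ i) 2, one_add_T_two_mul, ← mul_assoc,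
    show (2 : ℝ[X]) = Polynomial.C (2 : ℝ) from (map_ofNat Polynomial.C 2).symm, ← C_mul]
  norm_num

end Literature.Analysis.Fourier.TrigApprox

end
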